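import Summits.CriticalPhenomena.SAWScalingLimit.Theses.SAWDeterminantalDiagonal
import Literature.Probability.RandomPlanarGeometry.DiagonalDressedSAW
import HarnessLib

/-!
# `SAWDeterminantalDiagonal.DiagonalUniversality` (stmt-CriticalPhenomena-8247) — the glued split

Route `SAWDeterminantalDiagonal` of `CriticalPhenomena/SAWScalingLimit`, crux `DiagonalUniversality`
(rank 4): for every `x > 0`, if the discrepancy walk at fugacity `x` converges to chordal SLE_{8/3}
in every Dobrushin domain and for every endpoint approximation, then so does the critical SAW law.
Its conclusion is the conjunct `SAWScalingLimit` verbatim, so as a bare implication it is a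
RESTATEMENT of the summit under a hypothesis (route re-audit 2026-08-16, bin RESTATED). This file is
the ASSEMBLY of its typed decomposition (crux-strategist, BC2 redirect; the route's own two-layer
plan `CriticalCurve → ScoreDecoupling → DiagonalUniversality` made typed, after the idea card
`Ideas/_closed/universality-line-integral-score-decoupling.md`), over the diagonal dressed family
`P_{s,y} ∝ y^{|γ|} e^{sΦ(γ)}`, `Φ = m + 4 log pm⋆`, of
`Literature/Probability/RandomPlanarGeometry/DiagonalDressedSAW.lean`:

  `diagonalUniversality_of_subs : CriticalCurve → WindowRigidity → ScoreDecoupling → DiagonalUniversality`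

* `CriticalCurve`   — `∃ ξ, SAW.IsDiagonalCriticalCurve ξ`: a `C¹` positive fugacity curve on
  `[0, 1/2]` starting at `x_c` along which the dressed walk is window-critical (in probability
  neither ballistic nor dense, in every Dobrushin domain);
* `WindowRigidity`  — a fugacity at which the discrepancy walk (`s = 1/2`) converges to SLE_{8/3}
  is the unique window-critical fugacity at `s = 1/2`;
* `ScoreDecoupling` — along every critical curve, for every bounded continuous functional `f` of
  the curve, `∫₀^{1/2} |Cov_{s,δ}(f ∘ curve, score_s)| ds → 0` as `δ → 0⁺`
  (`score_s = Φ + (ξ'/ξ)|γ|`).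

## The proof (§1 calculus, §2 transfer, §3 glue)

§1 is the exponential-family ("fluctuation–response") calculus on the finite walk space:
`hasDerivAt_gibbsAverage` (if `∂_t w_t = w_t σ_t` then `(d/dt) E_t[F] = Cov_t(F, σ_t)`),
`hasDerivAt_diagonalWeight` (`∂_t (ξ(t)^{|γ|} e^{tΦ}) = w_t · score_t`),
`hasDerivAt_integral_diagonalLaw` (`(d/ds) ∫ F dP_{s,ξ(s)} = Cov_s(F, score_s)`, Mathlib's
`ProbabilityTheory.covariance`), `continuous_covariance_diagonalScore`, and the fundamental theorem
of calculus `integral_half_sub_integral_zero`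
(`∫ F dP_{1/2,ξ(1/2)} − ∫ F dP_{0,ξ(0)} = ∫₀^{1/2} Cov_s(F, score_s) ds`). §2
(`convergesInLawToSLE_law_of_diagonal`): `P_{0,x_c} = SAW.law`
(`SAW.diagonalLaw_zero_criticalFugacity`), `ξ(1/2) = x` by rigidity, and
`|∫ f∘curve dP_{1/2,x} − ∫ f∘curve dSAW.law| ≤ ∫₀^{1/2} |Cov_s| ds → 0` by decoupling, so the
SLE_{8/3} limit of the discrepancy walk transfers to `SAW.law`. §3 identifies the route's inlined
discrepancy law (`let pm`, `let m`, `let A`, `let L`) with `P_{1/2,x}`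
(`SAW.diagonalLaw_half_eq_discrepancyLaw`, definitional unfolding) and concludes the route decl
`DiagonalUniversality` by name. Shape `C₁ → C₂ → C₃ → C` for
`ledger route edit --split DiagonalUniversality --into … --glue-by
Summit.CriticalPhenomena.SAWScalingLimit.Theorems.diagonalUniversality_of_subs`.

No definitions; unconditional; standard axioms; no named facts.

## References

* M. J. Kozdron, G. F. Lawler, *The configurational measure on mutually avoiding SLE paths*,
  Fields Inst. Commun. 50 (2007), §6 [KozdronLawler2007].
* G. F. Lawler, O. Schramm, W. Werner, *On the scaling limit of planar self-avoiding walk*, Proc.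
  Sympos. Pure Math. 72 (2004), §3.4.2 [LawlerSchrammWerner2004SAW].
-/

noncomputable section

namespace Summit.CriticalPhenomena.SAWScalingLimit.Theorems

open MeasureTheory Filter Topology Set
open scoped NNReal ENNReal BoundedContinuousFunction
open Literature.Probability.RandomPlanarGeometry Literature.Probability.LatticeModels
open Literature.Probability.RandomPlanarGeometry.SAW
open Summit.CriticalPhenomena.SAWScalingLimit.Theses.SAWDeterminantalDiagonal

namespace Diagonal

/-! ### §1 The fluctuation–response calculus on the finite walk space -/

/-- **Fluctuation–response identity.** On a finite type, if the weights `w_t(i) > 0` are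
differentiable at `t = s` with `∂_t w_t(i)|_{t=s} = w_s(i) σ_s(i)`, then the Gibbs average of any
`F` is differentiable at `s` with derivative the Gibbs covariance
`E_s[F σ_s] − E_s[F] E_s[σ_s]`. (On an empty type both sides vanish.) [folklore] -/
theorem hasDerivAt_gibbsAverage {ι : Type*} [Fintype ι] {w σ : ℝ → ι → ℝ} {s : ℝ}
    (hw : ∀ i, HasDerivAt (fun t => w t i) (w s i * σ s i) s) (hpos : ∀ i, 0 < w s i)
    (F : ι → ℝ) :
    HasDerivAt (fun t => gibbsAverage (w t) F)
      (gibbsAverage (w s) (fun i => F i * σ s i) -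
        gibbsAverage (w s) F * gibbsAverage (w s) (σ s)) s := by
  rcases isEmpty_or_nonempty ι with hι | hι
  · have h0 : (fun t => gibbsAverage (w t) F) = fun _ => (0 : ℝ) :=
      funext fun t => by simp [gibbsAverage]
    rw [h0]
    simpa [gibbsAverage] using hasDerivAt_const s (0 : ℝ)
  · have hZ : (∑ i, w s i) ≠ 0 := (Finset.sum_pos (fun i _ => hpos i) Finset.univ_nonempty).ne'
    have hN : HasDerivAt (fun t => ∑ i, w t i * F i) (∑ i, w s i * σ s i * F i) s :=
      HasDerivAt.fun_sum fun i _ => (hw i).mul_const (F i)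
    have hD : HasDerivAt (fun t => ∑ i, w t i) (∑ i, w s i * σ s i) s :=
      HasDerivAt.fun_sum fun i _ => hw i
    have e1 : (∑ i, w s i * σ s i * F i) = ∑ i, w s i * (F i * σ s i) :=
      Finset.sum_congr rfl fun i _ => by ring
    refine (hN.div hD hZ).congr_deriv ?_
    rw [e1]
    unfold gibbsAverage
    field_simp

variable {Ω : Set ℂ} {δ : ℝ} {a b : Site 2}

/-- **The diagonal weight moves with the score**: along a fugacity curve `ξ` differentiable at `s`
with `ξ(s) > 0`, `∂_t (ξ(t)^{|γ|} e^{tΦ(γ)})|_{t=s} = w_s(γ) · (Φ(γ) + (ξ'(s)/ξ(s))·|γ|)`.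
[folklore] -/
theorem hasDerivAt_diagonalWeight {ξ : ℝ → ℝ} {ξ' s : ℝ} (hξ : HasDerivAt ξ ξ' s)
    (hpos : 0 < ξ s) (γ : DomainSAW Ω δ a b) :
    HasDerivAt (fun t => diagonalWeight t (ξ t) γ)
      (diagonalWeight s (ξ s) γ * (diagonalDressing γ + ξ' / ξ s * γ.length)) s := by
  have h1 : HasDerivAt (fun t => ξ t ^ γ.length) (γ.length * ξ s ^ (γ.length - 1) * ξ') s :=
    hξ.pow γ.length
  have h2 : HasDerivAt (fun t => Real.exp (t * diagonalDressing γ))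
      (Real.exp (s * diagonalDressing γ) * (1 * diagonalDressing γ)) s :=
    ((hasDerivAt_id s).mul_const _).exp
  refine (h1.mul h2).congr_deriv ?_
  unfold diagonalWeight
  rcases Nat.eq_zero_or_pos γ.length with h0 | hp
  · rw [h0]
    simp
  · obtain ⟨k, hk⟩ : ∃ k, γ.length = k + 1 := ⟨γ.length - 1, by omega⟩
    rw [hk, Nat.add_sub_cancel, pow_succ]
    field_simp
    push_cast
    ring

section Finite

variable [Fintype (DomainSAW Ω δ a b)]

/-- **`(d/ds) ∫ F dP_{s,ξ(s)} = Cov_s(F, score_s)`** on the finite walk space, for a fugacity curve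
differentiable at `s` and positive. [folklore] -/
theorem hasDerivAt_integral_diagonalLaw {ξ : ℝ → ℝ} {s : ℝ} (hξ : DifferentiableAt ℝ ξ s)
    (hpos : ∀ t, 0 < ξ t) (F : DomainSAW Ω δ a b → ℝ) :
    HasDerivAt (fun t => ∫ γ, F γ ∂(diagonalLaw Ω δ a b t (ξ t)))
      (ProbabilityTheory.covariance F (diagonalScore ξ s) (diagonalLaw Ω δ a b s (ξ s))) s := by
  have hfun : (fun t => ∫ γ, F γ ∂(diagonalLaw Ω δ a b t (ξ t))) =
      fun t => gibbsAverage (diagonalWeight t (ξ t)) F :=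
    funext fun t => integral_diagonalLaw (hpos t) F
  rw [hfun, covariance_diagonalLaw (hpos s)]
  have hw : ∀ γ : DomainSAW Ω δ a b, HasDerivAt (fun t => diagonalWeight t (ξ t) γ)
      (diagonalWeight s (ξ s) γ * diagonalScore ξ s γ) s :=
    fun γ => hasDerivAt_diagonalWeight hξ.hasDerivAt (hpos s) γ
  exact hasDerivAt_gibbsAverage (w := fun t γ => diagonalWeight t (ξ t) γ)
    (σ := fun t γ => diagonalScore ξ t γ) hw (fun γ => diagonalWeight_pos (hpos s) γ) F

/-- **Continuity of the score covariance in the dressing parameter** along a `C¹` positive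
fugacity curve (finite walk space: a rational function of continuous quantities with positive
denominator). [folklore] -/
theorem continuous_covariance_diagonalScore {ξ : ℝ → ℝ} (hξ : ContDiff ℝ 1 ξ)
    (hpos : ∀ t, 0 < ξ t) (F : DomainSAW Ω δ a b → ℝ) :
    Continuous fun s =>
      ProbabilityTheory.covariance F (diagonalScore ξ s) (diagonalLaw Ω δ a b s (ξ s)) := by
  have hfun : (fun s =>
      ProbabilityTheory.covariance F (diagonalScore ξ s) (diagonalLaw Ω δ a b s (ξ s))) =
      fun s => gibbsAverage (diagonalWeight s (ξ s)) (fun γ => F γ * diagonalScore ξ s γ) -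
        gibbsAverage (diagonalWeight s (ξ s)) F *
          gibbsAverage (diagonalWeight s (ξ s)) (diagonalScore ξ s) :=
    funext fun s => covariance_diagonalLaw (hpos s) _ _
  rw [hfun]
  have hξc : Continuous ξ := hξ.continuous
  have hdc : Continuous (deriv ξ) := hξ.continuous_deriv le_rfl
  have hwc : ∀ γ : DomainSAW Ω δ a b, Continuous fun s => diagonalWeight s (ξ s) γ := by
    intro γ
    unfold diagonalWeight
    exact (hξc.pow _).mul (Real.continuous_exp.comp (continuous_id.mul continuous_const))
  have hsc : ∀ γ : DomainSAW Ω δ a b, Continuous fun s => diagonalScore ξ s γ := by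
    intro γ
    unfold diagonalScore
    exact continuous_const.add ((hdc.div hξc fun t => (hpos t).ne').mul continuous_const)
  rcases isEmpty_or_nonempty (DomainSAW Ω δ a b) with hE | hN
  · simp only [gibbsAverage, Finset.univ_eq_empty, Finset.sum_empty, div_zero, zero_mul,
      sub_zero]
    exact continuous_const
  · have hZ : ∀ s, (∑ γ : DomainSAW Ω δ a b, diagonalWeight s (ξ s) γ) ≠ 0 := fun s =>
      sum_diagonalWeight_ne_zero (hpos s)
    have hga : ∀ G : ℝ → DomainSAW Ω δ a b → ℝ, (∀ γ, Continuous fun s => G s γ) →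
        Continuous fun s => gibbsAverage (diagonalWeight s (ξ s)) (G s) := by
      intro G hG
      unfold gibbsAverage
      exact (continuous_finsetSum _ fun γ _ => (hwc γ).mul (hG γ)).div
        (continuous_finsetSum _ fun γ _ => hwc γ) hZ
    exact (hga (fun s γ => F γ * diagonalScore ξ s γ) fun γ => continuous_const.mul (hsc γ)).sub
      ((hga (fun _ => F) fun _ => continuous_const).mul (hga (fun s => diagonalScore ξ s) hsc))

/-- **The line integral of score covariances** (fundamental theorem of calculus along the
diagonal): for a `C¹` positive fugacity curve,
`∫ F dP_{1/2, ξ(1/2)} − ∫ F dP_{0, ξ(0)} = ∫₀^{1/2} Cov_s(F, score_s) ds`. [folklore] -/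
theorem integral_half_sub_integral_zero {ξ : ℝ → ℝ} (hξ : ContDiff ℝ 1 ξ) (hpos : ∀ t, 0 < ξ t)
    (F : DomainSAW Ω δ a b → ℝ) :
    (∫ γ, F γ ∂(diagonalLaw Ω δ a b (1 / 2) (ξ (1 / 2)))) -
        ∫ γ, F γ ∂(diagonalLaw Ω δ a b 0 (ξ 0)) =
      ∫ s in (0 : ℝ)..(1 / 2),
        ProbabilityTheory.covariance F (diagonalScore ξ s) (diagonalLaw Ω δ a b s (ξ s)) := by
  rw [intervalIntegral.integral_eq_sub_of_hasDerivAt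
    (f := fun t => ∫ γ, F γ ∂(diagonalLaw Ω δ a b t (ξ t)))
    (fun s _ => hasDerivAt_integral_diagonalLaw (hξ.differentiable one_ne_zero s) hpos F)
    ((continuous_covariance_diagonalScore hξ hpos F).intervalIntegrable _ _)]

end Finite

/-! ### §2 Transfer of convergence to SLE_{8/3} down the diagonal -/

/-- **Transfer down the diagonal.** Assume (i) a critical curve of the diagonal family exists,
(ii) window rigidity at the discrepancy end, (iii) score decoupling along critical curves — the
three crux items of the split of `DiagonalUniversality` (route `SAWDeterminantalDiagonal`). Then,
for every fugacity `x > 0` at which the discrepancy walk converges to chordal SLE_{8/3} in every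
Dobrushin domain, the critical SAW law converges to chordal SLE_{8/3} in every Dobrushin domain and
for every endpoint approximation: `P_{0,x_c} = SAW.law`, `ξ(1/2) = x`, and
`|∫ f∘curve dP_{1/2,x} − ∫ f∘curve dSAW.law| = |∫₀^{1/2} Cov_s ds| ≤ ∫₀^{1/2} |Cov_s| ds → 0`.
[cite: LawlerSchrammWerner2004SAW, §3.4.2] -/
theorem convergesInLawToSLE_law_of_diagonal
    (hCurve : ∃ ξ : ℝ → ℝ, IsDiagonalCriticalCurve ξ)
    (hRigid : ∀ x : ℝ, 0 < x → DiscrepancyConvergesToSLE x →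
      ∀ y : ℝ, 0 < y → InDiagonalWindow (1 / 2) y → y = x)
    (hDecouple : ∀ ξ : ℝ → ℝ, IsDiagonalCriticalCurve ξ →
      ∀ (D : DobrushinDomain) (a b : ℝ → Site 2), IsEndpointApprox D a b →
        ∀ f : CurveClass ℂ →ᵇ ℝ,
          Tendsto (fun δ => ∫ s in (0 : ℝ)..(1 / 2),
            |ProbabilityTheory.covariance (fun γ => f γ.curve) (diagonalScore ξ s)
              (diagonalLaw D.carrier δ (a δ) (b δ) s (ξ s))|) (𝓝[>] (0 : ℝ)) (𝓝 0))
    {x : ℝ} (hx : 0 < x) (hDW : DiscrepancyConvergesToSLE x)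
    {D : DobrushinDomain} {a b : ℝ → Site 2} (hab : IsEndpointApprox D a b) :
    ConvergesInLawToSLE ((8 : ℝ≥0) / 3) D
      (fun δ (γ : DomainSAW D.carrier δ (a δ) (b δ)) => γ.curve)
      (fun δ => law D.carrier δ (a δ) (b δ)) := by
  obtain ⟨ξ, hξ⟩ := hCurve
  have hhalf : (1 / 2 : ℝ) ∈ Icc (0 : ℝ) (1 / 2) := ⟨by norm_num, le_rfl⟩
  have hyx : ξ (1 / 2) = x := hRigid x hx hDW (ξ (1 / 2)) (hξ.pos _) (hξ.window _ hhalf)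
  obtain ⟨Γ, hΓ, -, hlim⟩ := hDW D a b hab
  refine ⟨Γ, hΓ, Eventually.of_forall fun δ => aemeasurable_curve D.carrier δ (a δ) (b δ),
    fun f => ?_⟩
  have hdec := hDecouple ξ hξ D a b hab f
  have hdiff : Tendsto (fun δ =>
      (∫ γ, f γ.curve ∂(diagonalLaw D.carrier δ (a δ) (b δ) (1 / 2) x)) -
        ∫ γ, f γ.curve ∂(law D.carrier δ (a δ) (b δ))) (𝓝[>] (0 : ℝ)) (𝓝 0) := by
    refine squeeze_zero_norm' ?_ hdec
    filter_upwards [self_mem_nhdsWithin] with δ hδ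
    haveI := finite_domainSAW D.isBounded (Set.mem_Ioi.mp hδ) (a δ) (b δ)
    haveI : Fintype (DomainSAW D.carrier δ (a δ) (b δ)) := Fintype.ofFinite _
    rw [Real.norm_eq_abs, ← diagonalLaw_zero_criticalFugacity, ← hξ.zero, ← hyx,
      integral_half_sub_integral_zero hξ.contDiff hξ.pos (fun γ => f γ.curve)]
    exact intervalIntegral.abs_integral_le_integral_abs (by norm_num)
  have h1 := hlim f
  simpa only [sub_sub_cancel, sub_zero] using h1.sub hdiff

end Diagonal

/-! ### §3 The glue into the route decl -/

/-- **Glue of the split of `DiagonalUniversality`.** `CriticalCurve → WindowRigidity →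
ScoreDecoupling → DiagonalUniversality`: the hypothesis `(DW)` of the crux, stated with the
route's inlined discrepancy law, is `SAW.DiscrepancyConvergesToSLE x`
(`SAW.diagonalLaw_half_eq_discrepancyLaw`), and the transfer down the diagonal is
`Diagonal.convergesInLawToSLE_law_of_diagonal`. [cite: LawlerSchrammWerner2004SAW, §3.4.2] -/
theorem diagonalUniversality_of_subs
    (hCurve : ∃ ξ : ℝ → ℝ, SAW.IsDiagonalCriticalCurve ξ)
    (hRigid : ∀ x : ℝ, 0 < x → SAW.DiscrepancyConvergesToSLE x →
      ∀ y : ℝ, 0 < y → SAW.InDiagonalWindow (1 / 2) y → y = x)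
    (hDecouple : ∀ ξ : ℝ → ℝ, SAW.IsDiagonalCriticalCurve ξ →
      ∀ (D : DobrushinDomain) (a b : ℝ → Site 2), SAW.IsEndpointApprox D a b →
        ∀ f : CurveClass ℂ →ᵇ ℝ,
          Tendsto (fun δ => ∫ s in (0 : ℝ)..(1 / 2),
            |ProbabilityTheory.covariance (fun γ => f γ.curve) (SAW.diagonalScore ξ s)
              (SAW.diagonalLaw D.carrier δ (a δ) (b δ) s (ξ s))|) (𝓝[>] (0 : ℝ)) (𝓝 0)) :
    DiagonalUniversality := by
  intro x hx hDW D a b hab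
  have hDW' : SAW.DiscrepancyConvergesToSLE x := by
    intro D' a' b' hab'
    have h := hDW D' a' b' hab'
    convert h using 2
    exact SAW.diagonalLaw_half_eq_discrepancyLaw x
  exact Diagonal.convergesInLawToSLE_law_of_diagonal hCurve hRigid hDecouple hx hDW' hab

end Summit.CriticalPhenomena.SAWScalingLimit.Theorems
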